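import Summits.BirchSwinnertonDyer.BirchSwinnertonDyer.Theorems.ErratumRoadFiveNonSurjCornerSerreLevelExact
import Summits.BirchSwinnertonDyer.BirchSwinnertonDyer.Theorems.SignedLowerHalvesKobayashiLowerHalfLargeImageShadowSerreLevel
import Literature.NumberTheory.EllipticCurves.ArtinExponentThreeTorsionOfTamagawaProofs
import Literature.NumberTheory.EllipticCurves.OggFormulaTameTypesTwoProofs
import Literature.NumberTheory.EllipticCurves.TamagawaRingEquivProofs
import Literature.NumberTheory.DiophantineGeometry.TateAlgorithmRingEquivProofs
import Literature.NumberTheory.DiophantineGeometry.TateAlgorithmAdditiveProofs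
import HarnessLib

/-!
# Route `SignedLowerHalves` (K3), crux 3 `KobayashiLowerHalfLargeImage` (item stmt-BirchSwinnertonDyer-19001), line `shadow_seed`:
# A SHADOW PRIME DIVIDES THE SERRE LEVEL OF `ρ̄_{E,3}` EXACTLY ONCE — `q ∥ N(ρ̄_{E,3})`, THE DYADIC CASE INCLUDED
# (cell `bsd-ssimc`, width seat `bsd-line-slh-p1-w7` g2, lane (T4) of the host's split S35-7; `--supports stmt-BirchSwinnertonDyer-19001`)

WHAT.  `E/ℚ` elliptic, `ρ̄` a framed model of `E[3]` (`W.IsTorsionGaloisRep 3 ρ̄`), `ρ̄' = ρ̄ ⊗_j k` any extension of scalars,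
`N(ρ̄') = serreLevel 3 ρ̄'` Serre's level (the prime-to-`3` Artin conductor).  A **shadow prime** of the line `shadow_seed`
(`Cruxes/KobayashiLowerHalfLargeImage/Lines/shadow_seed.lean`, `IsShadowPrimeAt`) is a prime `q ≠ 3` of Kodaira type `IV` or `IV*`
whose mod-`3` shadow is non-split; on the census branch (`q ≡ 2 (mod 3)`, all 26 census pairs) this says `c_q = 3`.

* §1 `artinConductorAt_baseChange_eq_torsionGaloisRep` — bookkeeping: the real Artin conductor of `ρ̄ ⊗ k` at `𝔓` is that of
  the tree's `W.torsionGaloisRep p` (same fixed-space codimensions for every subgroup; number-field generality, any `p`).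
* §2 THE DYADIC SHADOW PRIME, UNCONDITIONAL: for `E/ℚ` of Kodaira type `IV` or `IV*` at `2` with `3 ∣ c_2`,
  `a_𝔓(E[3]) = 1` for every `𝔓 ∣ 2` (`artinConductorAt_torsionGaloisRep_three_eq_one_of_two`) and `a_2(ρ̄ ⊗ k) = 1`
  (`artinConductorExponent_baseChange_three_eq_one_of_two`): tame part `1` (w5's `codimFixed_inertia_torsionGaloisRep_three_eq_one`,
  `E[3]^{I_𝔓}` is exactly a line), Swan part `0` because OGG'S FORMULA AT `2` IS A THEOREM ON THE ROWS `IV`, `IV*`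
  (`swanConductorAt_rationalTate_eq_zero_of_kodairaSymbolAt_IV_or_IVstar_two`: `E` acquires good reduction over `ℚ₂(∛2)`) and
  `Sw_𝔓(V_3 E) = Sw_𝔓(E[3])` (Serre–Tate).  The Literature file `ArtinExponentThreeTorsionOfTamagawaProofs` has this case only
  modulo Ogg–Saito BY NAME (`…_add_one_eq_conductorExponent_…`); 15 of the 26 census shadow pairs have `q = 2`.
* §3 SERRE-LEVEL CURRENCY over `ℚ`, dyadic case: **`factorization_serreLevel_two_eq_one` — for `E/ℚ` with
  `kodairaSymbol ℤ_[2] (E/ℚ₂) ∈ {IV, IV*}` and `3 ∣ c(E/ℚ₂)`, `ord_2 N(ρ̄_{E,3} ⊗ k) = 1`, i.e. `2 ∥ N(ρ̄)`, UNCONDITIONAL**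
  (corner5's `factorization_serreLevel_eq` bookkeeping; `kodairaSymbolAt_eq_padic`, `localTamagawaNumber_padic_eq_holds`).  The odd
  shadow primes `q ≥ 5` (`ord_q N(ρ̄) = 1` at additive `q ∉ {2,3}` with `3 ∣ c_q`) are width seat w5's file
  `…KobayashiLowerHalfLargeImageShadowSerreLevel.lean` (host split S35-7); this file is its dyadic complement, so that together
  `q ∥ N(ρ̄_{E,3})` holds at EVERY shadow prime of the census (all have `c_q = 3`; 15 of the 26 pairs have `q = 2`).

WHY (line `shadow_seed`, composite binder `ShadowSeedTransport_OPEN`, first link «Diamond 1995 Thm 1.1 + Carayol gives the newform `g`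
of weight 2 and level `M ∣ N(ρ̄)` with `q ∥ M`»): `q ∥ N(ρ̄)` is the clause that makes the level-lowered `g` NEW AT `q` WITH `q ∥` LEVEL,
i.e. Steinberg ⊗ unramified at `q` — the Fouquet–Wan-locus shape (H3) the line transports from.  This file puts that clause in the
kernel at every shadow prime with `3 ∣ c_q` (the whole census: every census shadow prime has `c_q = 3`); the `q ≡ 1 (mod 3)`,
`c_q = 1` branch of the card (no census pair) is NOT covered (there `E[3]^{I_q}` is still a line but `3 ∤ c_q`; not in the tree).
HONEST FRAMING (D-0152): helper of a CLASS route; no stub of any line is closed (the line's load-bearing link FW21 Thm 5.1 is PRE);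
item 19001 NOT closed; no new definition, no named-fact hypothesis, no `sorry`; nothing is asserted about any particular curve;
BSD is not proved by any of this.  Line of record `kurihara_rigidity` r2 (LEAD's) untouched.
[cite: Serre1987, §1.2 (1.2.1)–(1.2.2), §4.6 Lemme 5 (4.6.3)] [cite: Kraus1997, p. 1143] [cite: Diamond1995RefinedSerre, Thm. 1.1]
[cite: SilvermanATAEC1994, Thm. IV.10.2, Thm. IV.11.1 and Table 4.1 (PDF pp. 358–366)] [cite: Saito1988, Theorem 1]
-/

set_option autoImplicit false
set_option linter.dupNamespace false

noncomputable section

open scoped Classical NumberField Pointwise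

open WeierstrassCurve Literature.NumberTheory Literature.NumberTheory.GaloisRepresentations
  Literature.NumberTheory.EllipticCurves Literature.NumberTheory.DiophantineGeometry
  Rat.HeightOneSpectrum IsDedekindDomain IsDedekindDomain.HeightOneSpectrum NumberField Field Module MeasureTheory
  Literature.NumberTheory.GaloisRepresentations.ModPGaloisRep
  Summit.BirchSwinnertonDyer.BirchSwinnertonDyer.Theorems.NonSurjCornerSerreLevelExact

namespace Summit.BirchSwinnertonDyer.BirchSwinnertonDyer.Theorems.ShadowSerreLevelDyadic

universe u

/-! ### §1 Bookkeeping: the framed model has the Artin conductor of `E[p]` -/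

/-- **`a_𝔓(ρ̄_{E,p} ⊗ k) = a_𝔓(E[p])`** (real item-G09 conductors) for a framed model `ρ̄` of `E[p]` over a number field and any
extension of scalars `j : 𝔽_p → k`: the fixed spaces of `ρ̄ ⊗ k` and of `E[p]` have the same codimension for EVERY subgroup
(`codimFixed_toContinuousRep_baseChange`, `IsTorsionGaloisRep.codimFixed_toGaloisRep_eq`), so the tame parts and the Swan integrands agree.
[cite: Serre1987, §4.6 Lemme 5 (4.6.3)] -/
theorem artinConductorAt_baseChange_eq_torsionGaloisRep
    {K : Type u} [Field K] [NumberField K] {W : WeierstrassCurve K} [W.IsElliptic]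
    {p : ℕ} [Fact p.Prime] {ρ : FramedGaloisRep K (ZMod p) 2} (hρ : W.IsTorsionGaloisRep p ρ)
    {k : Type*} [Field k] [TopologicalSpace k] [IsTopologicalRing k]
    (j : ZMod p →+* k) (hj : Continuous j) (𝔓 : Ideal (absIntegers (𝓞 K) K)) :
    letI : Module (ZMod p) (geomTorsion W p) := AddSubgroup.torsionBy.zmodModule
    (FramedGaloisRep.toGaloisRep (ρ.baseChange j hj)).artinConductorAt (𝓞 K) 𝔓 =
      (W.torsionGaloisRep p).artinConductorAt (𝓞 K) 𝔓 := by
  letI : Module (ZMod p) (geomTorsion W p) := AddSubgroup.torsionBy.zmodModule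
  have hp0 : ((p : ℕ) : K) ≠ 0 := Nat.cast_ne_zero.mpr (Fact.out : p.Prime).ne_zero
  have hcodim : ∀ H : Subgroup (absoluteGaloisGroup K),
      (FramedGaloisRep.toGaloisRep (ρ.baseChange j hj)).codimFixed H = (W.torsionGaloisRep p).codimFixed H :=
    fun H ↦ (Literature.NumberTheory.Automorphic.BCDT.codimFixed_toContinuousRep_baseChange ρ j hj H).trans
      (hρ.codimFixed_toGaloisRep_eq hp0 H)
  have hsw : (FramedGaloisRep.toGaloisRep (ρ.baseChange j hj)).swanConductorAt (𝓞 K) 𝔓 =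
      (W.torsionGaloisRep p).swanConductorAt (𝓞 K) 𝔓 := by
    rw [GaloisRep.swanConductorAt_def, GaloisRep.swanConductorAt_def]
    refine setIntegral_congr_fun measurableSet_Ioi fun u _ ↦ ?_
    simp only [hcodim]
  rw [GaloisRep.artinConductorAt_def, GaloisRep.artinConductorAt_def, hcodim, hsw]

/-! ### §2 The dyadic shadow prime: `a_2(E[3]) = 1`, unconditionally -/

/-- The residue characteristic of a place `v ∋ 2` of `ℚ` is not `3`, read as `3 ∉ v`. [folklore] -/
private theorem three_not_mem_of_two_mem {v : HeightOneSpectrum (𝓞 ℚ)} (hv : (2 : 𝓞 ℚ) ∈ v.asIdeal) :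
    (3 : 𝓞 ℚ) ∉ v.asIdeal := by
  intro h3
  have h1 : (1 : 𝓞 ℚ) ∈ v.asIdeal := by
    have := v.asIdeal.sub_mem h3 hv
    convert this using 1
    norm_num
  exact v.isPrime.ne_top ((Ideal.eq_top_iff_one _).mpr h1)

/-- A place of Kodaira type `IV` or `IV*` is a place of additive reduction (`isAdditive_kodairaSymbolAt_iff_holds`).
[cite: SilvermanATAEC1994, Table 4.1 (PDF p. 365)] -/
theorem hasAdditiveReductionAt_of_kodairaSymbolAt_IV_or_IVstar (W : WeierstrassCurve ℚ) [W.IsElliptic]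
    {v : HeightOneSpectrum (𝓞 ℚ)} (hT : W.kodairaSymbolAt v = .IV ∨ W.kodairaSymbolAt v = .IVstar) :
    W.HasAdditiveReductionAt v := by
  haveI : PerfectField (IsLocalRing.ResidueField (v.adicCompletionIntegers ℚ)) := PerfectField.ofFinite
  refine (W.isAdditive_kodairaSymbolAt_iff_holds v).mp ?_
  rcases hT with h | h <;> rw [h] <;> decide

/-- **`a_𝔓(E[3]) = 1` at a DYADIC shadow prime, unconditionally.**  For an elliptic curve `E/ℚ` of Kodaira type `IV` or `IV*`
at the place `v ∋ 2` with `3 ∣ c_v`, and every prime `𝔓 ∣ v` of `\bar ℤ`: the Artin conductor of the `3`-torsion at `𝔓` is `1`.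
Tame part `1` (`codimFixed_inertia_torsionGaloisRep_three_eq_one`: `E[3]^{I_𝔓}` is exactly a line); Swan part `0`: Ogg's
formula at `2` on the rows `IV`, `IV*` (`swanConductorAt_rationalTate_eq_zero_of_kodairaSymbolAt_IV_or_IVstar_two`: good
reduction over `ℚ₂(∛2)`, so the wild ramification groups fix `E[3]`) read on the torsion
(`swanConductorAt_rationalTate_eq_swanConductorAt_torsion`).
[cite: SilvermanATAEC1994, Thm. IV.10.2 and Thm. IV.11.1, Table 4.1 (PDF pp. 358–366)] [cite: Saito1988, Theorem 1] -/
theorem artinConductorAt_torsionGaloisRep_three_eq_one_of_two (W : WeierstrassCurve ℚ) [W.IsElliptic]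
    {v : HeightOneSpectrum (𝓞 ℚ)} (hv : (2 : 𝓞 ℚ) ∈ v.asIdeal)
    (hT : W.kodairaSymbolAt v = .IV ∨ W.kodairaSymbolAt v = .IVstar)
    (hdvd : 3 ∣ (W.baseChange (v.adicCompletion ℚ)).localTamagawaNumber (v.adicCompletionIntegers ℚ))
    {𝔓 : Ideal (absIntegers (𝓞 ℚ) ℚ)} (h𝔓 : 𝔓 ∈ v.primesAbove) :
    letI : Module (ZMod 3) (geomTorsion W (3 : ℕ)) := AddSubgroup.torsionBy.zmodModule
    (W.torsionGaloisRep 3).artinConductorAt (𝓞 ℚ) 𝔓 = 1 := by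
  letI : Module (ZMod 3) (geomTorsion W (3 : ℕ)) := AddSubgroup.torsionBy.zmodModule
  have h3v : (3 : 𝓞 ℚ) ∉ v.asIdeal := three_not_mem_of_two_mem hv
  have h3v' : ((3 : ℕ) : 𝓞 ℚ) ∉ v.asIdeal := by exact_mod_cast h3v
  have hadd : W.HasAdditiveReductionAt v := hasAdditiveReductionAt_of_kodairaSymbolAt_IV_or_IVstar W hT
  have h := W.continuous_rationalGaloisRepTate_holds 3
  rw [GaloisRep.artinConductorAt_def, W.codimFixed_inertia_torsionGaloisRep_three_eq_one hadd h3v hdvd h𝔓,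
    ← W.swanConductorAt_rationalTate_eq_swanConductorAt_torsion 3 h h3v' h𝔓,
    W.swanConductorAt_rationalTate_eq_zero_of_kodairaSymbolAt_IV_or_IVstar_two 3 h hv hT h3v' h𝔓]
  norm_num

/-- **`a_v(ρ̄_{E,3} ⊗ k) = 1` at a dyadic shadow prime** (exponent form, `v ∋ 2`, Kodaira `IV`/`IV*` at `v`, `3 ∣ c_v`; `ρ̄` a framed
model of `E[3]`, `j : 𝔽₃ → k`): `⌊a_𝔓(ρ̄ ⊗ k)⌋₊ = ⌊1⌋₊ = 1` at the chosen `𝔓 ∣ v`.  Unconditional; the Literature file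
`ArtinExponentThreeTorsionOfTamagawaProofs` has the dyadic case only modulo Ogg–Saito by name.
[cite: SilvermanATAEC1994, Thm. IV.10.2 and Thm. IV.11.1 (PDF pp. 358–366)] [cite: Serre1987, §4.6 Lemme 5 (4.6.3)] -/
theorem artinConductorExponent_baseChange_three_eq_one_of_two (W : WeierstrassCurve ℚ) [W.IsElliptic]
    {ρ : FramedGaloisRep ℚ (ZMod 3) 2} (hρ : W.IsTorsionGaloisRep 3 ρ)
    {k : Type*} [Field k] [TopologicalSpace k] [IsTopologicalRing k]
    (j : ZMod 3 →+* k) (hj : Continuous j)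
    {v : HeightOneSpectrum (𝓞 ℚ)} (hv : (2 : 𝓞 ℚ) ∈ v.asIdeal)
    (hT : W.kodairaSymbolAt v = .IV ∨ W.kodairaSymbolAt v = .IVstar)
    (hdvd : 3 ∣ (W.baseChange (v.adicCompletion ℚ)).localTamagawaNumber (v.adicCompletionIntegers ℚ)) :
    (FramedGaloisRep.toGaloisRep (ρ.baseChange j hj)).artinConductorExponent v = 1 := by
  letI : Module (ZMod 3) (geomTorsion W (3 : ℕ)) := AddSubgroup.torsionBy.zmodModule
  unfold GaloisRep.artinConductorExponent
  rw [artinConductorAt_baseChange_eq_torsionGaloisRep hρ j hj,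
    artinConductorAt_torsionGaloisRep_three_eq_one_of_two W hv hT hdvd (HeightOneSpectrum.primesAbove_nonempty v).some_mem]
  norm_num

/-! ### §3 Serre-level currency over `ℚ`: `q ∥ N(ρ̄_{E,3})` at every shadow prime -/

/-- **`2 ∥ N(ρ̄_{E,3} ⊗ k)` at a dyadic shadow prime, unconditionally**: for `E/ℚ` of Kodaira type `IV` or `IV*` over `ℤ₂` with
`3 ∣ c_2 = c(E/ℚ₂)`, the exponent of `2` in Serre's level of the mod-`3` representation is `1` (whereas `f_2(E) = 2`): the
level-lowered newform attached to `ρ̄_{E,3}` is new at `2` with `2 ∥` its level.  (`artinConductorExponent_baseChange_three_eq_one_of_two`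
read through corner5's `factorization_serreLevel_eq`; Kodaira symbol and Tamagawa number over `ℤ_[2]` by `kodairaSymbolAt_eq_padic`,
`localTamagawaNumber_padic_eq_holds`.) [cite: Serre1987, §1.2 (1.2.1)–(1.2.2), §4.6 Lemme 5 (4.6.3)] [cite: Kraus1997, p. 1143]
[cite: SilvermanATAEC1994, Thm. IV.11.1 and Table 4.1] -/
theorem factorization_serreLevel_two_eq_one (W : WeierstrassCurve ℚ) [W.IsElliptic]
    {ρ : ModPGaloisRep ℚ (ZMod 3) 2} (hρ : W.IsTorsionGaloisRep 3 ρ)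
    {k : Type*} [Field k] [TopologicalSpace k] [IsTopologicalRing k] (j : ZMod 3 →+* k) (hj : Continuous j)
    (hT : (W.baseChange ℚ_[2]).kodairaSymbol ℤ_[2] = .IV ∨ (W.baseChange ℚ_[2]).kodairaSymbol ℤ_[2] = .IVstar)
    (hc : 3 ∣ (W.baseChange ℚ_[2]).localTamagawaNumber ℤ_[2]) :
    (serreLevel 3 (FramedRep.baseChange j hj ρ)).factorization 2 = 1 := by
  classical
  set v : HeightOneSpectrum (𝓞 ℚ) := (primesEquiv (R := 𝓞 ℚ)).symm ⟨2, Nat.prime_two⟩ with hvdef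
  have hv : (primesEquiv v : Nat.Primes) = ⟨2, Nat.prime_two⟩ := Equiv.apply_symm_apply _ _
  have hvq : ((primesEquiv v : Nat.Primes) : ℕ) = 2 := by rw [hv]
  have hv2 : (2 : 𝓞 ℚ) ∈ v.asIdeal := by
    exact_mod_cast
      (Literature.NumberTheory.Automorphic.BCDT.natCast_mem_asIdeal_iff_primesEquiv_eq v Nat.prime_two).mpr hvq
  -- the Kodaira symbol and the Tamagawa number at `v`, from the data over `ℤ_[2]`
  have hKv : W.kodairaSymbolAt v = .IV ∨ W.kodairaSymbolAt v = .IVstar := by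
    have hKp := kodairaSymbolAt_eq_padic v W
    rw [hv] at hKp
    rw [hKp]
    exact hT
  have hcv : 3 ∣ (W.baseChange (v.adicCompletion ℚ)).localTamagawaNumber (v.adicCompletionIntegers ℚ) := by
    rw [← localTamagawaNumber_padic_eq_holds W v 2 hvq]
    exact hc
  have hexp := artinConductorExponent_baseChange_three_eq_one_of_two W hρ j hj hv2 hKv hcv
  have key : (serreLevel 3 (FramedRep.baseChange j hj ρ)).factorization ((primesEquiv v : Nat.Primes) : ℕ) = 1 := by
    rw [factorization_serreLevel_eq 3 _ (mulSupport_serreLevel_baseChange_finite W 3 hρ j hj) v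
      (by rw [hvq]; decide), hexp]
  rwa [hvq] at key

/-! ### §4 Every shadow prime at once (appended): `q ∥ N(ρ̄_{E,3})` for all `q ≠ 3` of type `IV`/`IV*` with `3 ∣ c_q` -/

/-- **`q ∥ N(ρ̄_{E,3} ⊗ k)` at EVERY shadow prime `q` with `3 ∣ c_q` — one statement, all `q ≠ 3`, unconditional.**  For `E/ℚ`, a
framed model `ρ̄` of `E[3]`, `j : 𝔽₃ → k`, and a prime `q ≠ 3` with `kodairaSymbol ℤ_[q] (E/ℚ_q) ∈ {IV, IV*}` and `3 ∣ c(E/ℚ_q)`: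
`ord_q N(ρ̄ ⊗ k) = 1`.  The dyadic prime is §3 (`factorization_serreLevel_two_eq_one`, Ogg at `2` on the rows `IV`, `IV*`); an odd
`q ≥ 5` is width seat w5's `ShadowSeedSerreLevel.factorization_serreLevel_baseChange_three_eq_one_of_dvd_localTamagawaNumber` (host
split S35-7), the types `IV`, `IV*` being additive (`hasAdditiveReductionAt_of_kodairaSymbolAt_IV_or_IVstar`,
`not_good_not_mult_of_hasAdditiveReductionAt_ringOfIntegers`).  These are the hypotheses of the line's `IsShadowPrimeAt W q` on its census
branch `q ≡ 2 (mod 3)` (`c_q = 3`; all 26 census pairs, 15 of them dyadic); the branch `q ≡ 1 (mod 3)`, `c_q = 1` is not covered.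
For the line: Diamond's level-lowered newform has level `M ∣ N(ρ̄)` with `ord_q M ≤ 1`.
[cite: Serre1987, §1.2 (1.2.1)–(1.2.2), §4.6 Lemme 5 (4.6.3)] [cite: Diamond1995RefinedSerre, Thm. 1.1]
[cite: SilvermanATAEC1994, Thm. IV.10.2, Thm. IV.11.1 and Table 4.1] [cite: Kraus1997, p. 1143] -/
theorem factorization_serreLevel_eq_one_of_kodairaSymbol_IV_or_IVstar (W : WeierstrassCurve ℚ) [W.IsElliptic]
    {ρ : ModPGaloisRep ℚ (ZMod 3) 2} (hρ : W.IsTorsionGaloisRep 3 ρ)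
    {k : Type*} [Field k] [TopologicalSpace k] [IsTopologicalRing k] (j : ZMod 3 →+* k) (hj : Continuous j)
    (q : ℕ) [Fact q.Prime] (hq3 : q ≠ 3)
    (hT : (W.baseChange ℚ_[q]).kodairaSymbol ℤ_[q] = .IV ∨ (W.baseChange ℚ_[q]).kodairaSymbol ℤ_[q] = .IVstar)
    (hc : 3 ∣ (W.baseChange ℚ_[q]).localTamagawaNumber ℤ_[q]) :
    (serreLevel 3 (FramedRep.baseChange j hj ρ)).factorization q = 1 := by
  classical
  have hq : q.Prime := Fact.out
  by_cases hq2 : q = 2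
  · subst hq2
    exact factorization_serreLevel_two_eq_one W hρ j hj hT hc
  · -- `q ≥ 5`: the types `IV`, `IV*` are additive, and the odd case is w5's theorem
    set v : HeightOneSpectrum (𝓞 ℚ) := (primesEquiv (R := 𝓞 ℚ)).symm ⟨q, hq⟩ with hvdef
    have hv : (primesEquiv v : Nat.Primes) = ⟨q, hq⟩ := Equiv.apply_symm_apply _ _
    have hKv : W.kodairaSymbolAt v = .IV ∨ W.kodairaSymbolAt v = .IVstar := by
      have hKp := kodairaSymbolAt_eq_padic v W
      rw [hv] at hKp
      rw [hKp]
      exact hT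
    have hadd : W.HasAdditiveReductionAt v := hasAdditiveReductionAt_of_kodairaSymbolAt_IV_or_IVstar W hKv
    obtain ⟨hng, hnm⟩ := not_good_not_mult_of_hasAdditiveReductionAt_ringOfIntegers W q hadd
    exact ShadowSeedSerreLevel.factorization_serreLevel_baseChange_three_eq_one_of_dvd_localTamagawaNumber W hρ j hj
      q hq2 hq3 hng hnm hc

end Summit.BirchSwinnertonDyer.BirchSwinnertonDyer.Theorems.ShadowSerreLevelDyadic

end
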